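import Mathlib
import Summits.NavierStokesRegularity.NavierStokesRegularity.Theorems.TypeIQuarterGateScarEnvelopeTypeISatelliteTowerHullRecurrent

/-!
# Satellite tower for crux `ScarEnvelopeTypeI` (stmt-NavierStokesRegularity-23843) — ROUND-45 Part B: THE ENEMY IS UNIFORMLY RECURRENT (A2 hulls are transitive; Z10 ★★ normal form with recurrence; Z11 ★★ 23843 ⟸ (ρ); Z13 ★★ the three cells intrinsic)

Part B of nsreg-p3 g28's ROUND-45 artefact minus Z12/Z12′ (landing form (25b)): A2 `exists_scales_tendsto_of_hull_of_hull` (scaling hulls are transitive);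
Z10 ★★ `recurrent_doublyMin_of_not_scarEnvelopeTypeI` (¬23843 ⇒ a doubly-minimal rooted census object UNIFORMLY RECURRENT under the Navier–Stokes scaling in
`L³_loc`, with the cell data of ROUND-44 Z6: in the DSS cell a periodic orbit, in the DSS-free cell by A1); Z11 ★★ `scarEnvelopeTypeI_of_noRecurrentDoublyMin`
(23843 ⟸ (ρ) «no doubly-minimal rooted census object is uniformly recurrent under scaling» — ONE restricted Liouville hypothesis replacing (τ) ∧ (κ) ∧ (θ));
Z13 ★★ `scarEnvelopeTypeI_of_recurrentCellExclusions` ((τ), (κ), (θ′) intrinsic — the DSS-free cell no longer mentions T6's model `w`).  Z12/Z12′ (the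
1589-conditional edge) are the separate module `…SatelliteTowerHullBirkhoffEdge` (DIRECTOR-NS #262).  CONDITIONAL statements (Z11, Z13: audit
`proof.conditional`, 23843 under UNREGISTERED exclusion hypotheses, same class as ROUND-44 Z8) credit nothing; item 23843 is OPEN.

PROVENANCE: declaration texts VERBATIM from the HOME artefact of the instrument seat nsreg-p3 g28 (cell `pub/ns-regularity-ideate`):
`round-45/Birkhoff45.lean` (sha16 `f8170ff5aabdcd25`, parts `partA45…partD45.lean`; a module written against the TREE, importing route
RecurrentProfiles' crux-1589 dynamics modules and the Literature dynamics BY NAME; its Part Z = ROUND-44 is already in the tree as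
`…SatelliteTowerHullJunction/…HullDichotomy/…DssNecklace/…DssCell/…HullCells/…HullEdge`, p664756…p666018), scored by referee ref3
(`SCORE-p3-ROUND-45-0828.md` cba78f676c9340cc, PASS TEXT+LEAN ★★ 21:02:16Z); the author cannot write under `Theorems/` (`perm.theorems-prover-only`); landed by the prover
ns-es-p1 g6 as landing hand of record (director-ns DIRECTOR-NS #237 (3)), split into ≤ 400-line modules, the artefact's
`#guard_msgs … #print axioms` certificates not landed.  `--supports stmt-NavierStokesRegularity-23843 --as helper`.

HONEST FRAMING: NORMAL FORM / JUNCTION / MECHANISM / METER theorems about HYPOTHETICAL Type-I zoom limits (Albritton–Barker objects of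
the census of crux `TypeIQuarterGate.ScarEnvelopeTypeI`, item 23843).  Movement 0 on anything open: item 23843, route TypeIQuarterGate,
crux 1589 `RecurrentLiouville`, crux 22144 `FiniteDissipationLiouville`, the statements (ρ), (θ′), (υ), the DSS cells (τ), (κ), N0 and
Navier–Stokes regularity are all OPEN — NS regularity is NOT proved here.  IN-TREE DISCLOSURE (cited by name, not re-derived):
Furstenberg 1981 Thms 1.15/1.17 (`Literature/Dynamics/TopologicalDynamics/{UniformRecurrence,MinimalOrbitClosure}.lean`), the `L³_loc`
slab-field model `SlabField` (`Literature/Analysis/FluidPDE/ScalingRecurrentSlabField.lean`), `exists_orbit_limit` (Albritton–Barker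
compactness), `stub_prJointContinuity`, `rlNearIdentityDSS_ae_comp_dilation` (route RecurrentProfiles / SqueezeCycle lineage), the PROVED
tree theorem `pineauVicol2026_oneSlice_regularity_holds` (Pineau–Vicol 2026 Thm 1.9) and the KNSS pressure package
`ChiralWindowDoorClassDerivDecay.exists_classical_scaleInvariantBounds_of_class`.  The same two moves exist EARLIER in crux 22144's
lineage (`FiniteDissipationLiouville.…HullCategoryMinimal.recurrent_of_orbitLimit`, `…Envelope.pv_unsteadiness_floor_of_minimal`) for a
different class; here they are proved independently for the Albritton–Barker class — NOT a new mechanism.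
-/

-- the summit-side namespace repeats a component by design (single-conjunct summit, D-0017)
set_option linter.dupNamespace false

open MeasureTheory Set Metric Filter Topology
open scoped ENNReal NNReal InnerProductSpace
open Literature.Analysis.FluidPDE
open Literature.Dynamics.TopologicalDynamics

namespace Summit.NavierStokesRegularity.NavierStokesRegularity.Cruxes.ScarEnvelopeTypeI.ZoomDictionary

section HullJunction

variable {U U₁ U₂ W : ℝ → (EuclideanSpace ℝ (Fin 3)) → (EuclideanSpace ℝ (Fin 3))}
  {P : ℝ → (EuclideanSpace ℝ (Fin 3)) → ℝ}
  {H : ℝ → (EuclideanSpace ℝ (Fin 3)) → (EuclideanSpace ℝ (Fin 3)) →L[ℝ] (EuclideanSpace ℝ (Fin 3))}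
  {M : ℝ}

/-! ## ROUND 45 — Part B.  THE ENEMY IS UNIFORMLY RECURRENT: the census reading of A1.

Z10 (normal form ★★): `¬ 23843` ⇒ a DOUBLY-MINIMAL ROOTED census object `U` which is UNIFORMLY RECURRENT under
the Navier–Stokes scaling in `L³_loc` (in the DSS cell trivially; in the DSS-free cell by A1, `U` being a hull
point of the uniformly recurrent model `w` of T6).  Z11: hence 23843 ⟸ the SINGLE restricted Liouville statement
(ρ) «no doubly-minimal rooted census object is uniformly recurrent under scaling»; Z12: (ρ) ⟸ crux 1589.
Z13: the three cells of Z8 become INTRINSIC — the DSS-free cell no longer mentions the auxiliary model `w`: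
«no DSS-free, uniformly recurrent, doubly-minimal rooted census object with DSS-free hull» (hull transitivity A2). -/

/-- **A2.  Scaling hulls are transitive.**  If `U` is an `L³_loc` scaling limit of `w` (`w_{l_k} → U`) and `v`
one of `U` (`U_{m_k} → v`), then `v` is an `L³_loc` scaling limit of `w` along some scales `μ_k > 0`
(orbit closures are closed and invariant; sequential closure in the pseudo-metrisable slab-field model). -/
theorem exists_scales_tendsto_of_hull_of_hull
    {w U v : ℝ → (EuclideanSpace ℝ (Fin 3)) → (EuclideanSpace ℝ (Fin 3))}
    (hw : ∀ R : ℝ, 0 < R → MemLp (Function.uncurry w) 3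
      (volume.restrict (parabolicCylinder R (0 : ℝ × (EuclideanSpace ℝ (Fin 3))))))
    (hU : ∀ R : ℝ, 0 < R → MemLp (Function.uncurry U) 3
      (volume.restrict (parabolicCylinder R (0 : ℝ × (EuclideanSpace ℝ (Fin 3))))))
    (hv : ∀ R : ℝ, 0 < R → MemLp (Function.uncurry v) 3
      (volume.restrict (parabolicCylinder R (0 : ℝ × (EuclideanSpace ℝ (Fin 3))))))
    {l : ℕ → ℝ} (hl : ∀ k, 0 < l k)
    (hlim : ∀ R : ℝ, 0 < R → Tendsto (fun k => eLpNorm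
      (Function.uncurry (nsRescale (l k) w) - Function.uncurry U) 3
      (volume.restrict (parabolicCylinder R (0 : ℝ × (EuclideanSpace ℝ (Fin 3)))))) atTop (𝓝 0))
    {m : ℕ → ℝ} (hm : ∀ k, 0 < m k)
    (hlim' : ∀ R : ℝ, 0 < R → Tendsto (fun k => eLpNorm
      (Function.uncurry (nsRescale (m k) U) - Function.uncurry v) 3
      (volume.restrict (parabolicCylinder R (0 : ℝ × (EuclideanSpace ℝ (Fin 3)))))) atTop (𝓝 0)) :
    ∃ μ : ℕ → ℝ, (∀ k, 0 < μ k) ∧ ∀ R : ℝ, 0 < R → Tendsto (fun k => eLpNorm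
      (Function.uncurry (nsRescale (μ k) w) - Function.uncurry v) 3
      (volume.restrict (parabolicCylinder R (0 : ℝ × (EuclideanSpace ℝ (Fin 3)))))) atTop (𝓝 0) := by
  classical
  haveI h13 : Fact (1 ≤ (3 : ℝ≥0∞)) := ⟨by norm_num⟩
  let x₀ : SlabField (EuclideanSpace ℝ (Fin 3)) (EuclideanSpace ℝ (Fin 3)) 3 := SlabField.ofMemLp w hw
  let z : SlabField (EuclideanSpace ℝ (Fin 3)) (EuclideanSpace ℝ (Fin 3)) 3 := SlabField.ofMemLp U hU
  let y : SlabField (EuclideanSpace ℝ (Fin 3)) (EuclideanSpace ℝ (Fin 3)) 3 := SlabField.ofMemLp v hv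
  -- `z ∈ hull(x₀)` and `y ∈ hull(z)`
  have hz : z ∈ closure (range fun σ => SlabField.flow σ x₀) := by
    refine mem_closure_of_tendsto (f := fun k => SlabField.flow (Real.log (l k)) x₀) (b := atTop) ?_
      (Eventually.of_forall fun k => ⟨Real.log (l k), rfl⟩)
    rw [SlabField.tendsto_iff_forall]
    intro R' hR'
    refine (hlim R' hR').congr fun k => ?_
    rw [SlabField.flow_log_toFun (hl k)]
    rfl
  have hy : y ∈ closure (range fun σ => SlabField.flow σ z) := by
    refine mem_closure_of_tendsto (f := fun k => SlabField.flow (Real.log (m k)) z) (b := atTop) ?_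
      (Eventually.of_forall fun k => ⟨Real.log (m k), rfl⟩)
    rw [SlabField.tendsto_iff_forall]
    intro R' hR'
    refine (hlim' R' hR').congr fun k => ?_
    rw [SlabField.flow_log_toFun (hm k)]
    rfl
  -- orbit closures are closed and invariant: `hull(z) ⊆ hull(x₀)`
  have hy' : y ∈ closure (range fun σ => SlabField.flow σ x₀) := by
    have hsub : (range fun σ => SlabField.flow σ z) ⊆ closure (range fun σ => SlabField.flow σ x₀) := by
      rintro _ ⟨σ, rfl⟩
      exact SlabField.mapsTo_flow_closure_orbit σ x₀ hz
    exact closure_minimal hsub isClosed_closure hy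
  -- sequential closure (the model is pseudo-metrisable)
  obtain ⟨xs, hxs, hxy⟩ := mem_closure_iff_seq_limit.1 hy'
  choose σs hσs using hxs
  refine ⟨fun k => Real.exp (σs k), fun k => Real.exp_pos _, ?_⟩
  have h : Tendsto (fun k => SlabField.flow (σs k) x₀) atTop (𝓝 y) := hxy.congr fun k => (hσs k).symm
  intro R hR
  have h' := ((SlabField.tendsto_flow_iff_forall _ _ _).1 h) R hR
  exact h'

/-- ★★ **Z10.  NORMAL FORM WITH RECURRENCE: the enemy is a UNIFORMLY RECURRENT doubly-minimal rooted object.**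
If 23843 fails, there is an exact-critical class and a census object `U`, doubly minimal at EVERY centre, rooted
(`¬ RegPt U 0`), which is UNIFORMLY RECURRENT under the Navier–Stokes scaling in `L³_loc` (Birkhoff almost
periodicity), and which lies in one of the two cells of Z6: exactly past-DSS with factor group `λ₀^ℤ`,
`λ₀ ≥ Λ(I₀) > 1` (with the tame/leaf/necklace data), or past-DSS-free inside the DSS-free hull of a uniformly
recurrent model.  The recurrence in the first cell is that of a periodic orbit; in the second it is A1 (Birkhoff on
the hull: `U` is a hull point of the uniformly recurrent `w`). -/
theorem recurrent_doublyMin_of_not_scarEnvelopeTypeI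
    (h : ¬ Summit.NavierStokesRegularity.NavierStokesRegularity.Theses.TypeIQuarterGate.ScarEnvelopeTypeI) :
    ∃ (M : ℝ) (I₀ : ℝ≥0∞) (Λ : ℝ), I₀ < ⊤ ∧ levelCrit I₀ ∈ Icc epsL M ∧ minLevel I₀ ≤ I₀ ∧ 1 < Λ ∧
      ∃ (U : ℝ → (EuclideanSpace ℝ (Fin 3)) → (EuclideanSpace ℝ (Fin 3))) (P : ℝ → (EuclideanSpace ℝ (Fin 3)) → ℝ)
        (H : ℝ → (EuclideanSpace ℝ (Fin 3)) → (EuclideanSpace ℝ (Fin 3)) →L[ℝ] (EuclideanSpace ℝ (Fin 3))),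
        (∀ y : (EuclideanSpace ℝ (Fin 3)), DoublyMin I₀ ⟨U, P, H, y⟩) ∧ ¬ RegPt U 0 ∧
        IsScalingUniformlyRecurrent U ∧
        ((∃ lam0 : ℝ, Λ ≤ lam0 ∧ (∀ t < 0, ∀ x, nsRescale lam0 U t x = U t x) ∧
            (∀ c : ℝ, 0 < c → ((∀ t < 0, ∀ x, nsRescale c U t x = U t x) ↔ ∃ k : ℤ, c = lam0 ^ k)) ∧
            (TameRoot ⟨U, P, H, 0⟩ ↔ LeafNode ⟨U, P, H, 0⟩) ∧
            (TameRoot ⟨U, P, H, 0⟩ ↔ ∃ A : ℝ, HasTypeIDecay A U) ∧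
            (¬ TameRoot ⟨U, P, H, 0⟩ ↔ ∃ y : (EuclideanSpace ℝ (Fin 3)), y ≠ 0 ∧ ¬ RegPt U y) ∧
            (∀ y : (EuclideanSpace ℝ (Fin 3)), ¬ RegPt U y → ∀ k : ℤ, ¬ RegPt U ((lam0 ^ k) • y))) ∨
         ((∀ c : ℝ, 0 < c → (∀ t < 0, ∀ x, nsRescale c U t x = U t x) → c = 1) ∧
          ∃ (w : ℝ → (EuclideanSpace ℝ (Fin 3)) → (EuclideanSpace ℝ (Fin 3))) (q : ℝ → (EuclideanSpace ℝ (Fin 3)) → ℝ)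
            (G : ℝ → (EuclideanSpace ℝ (Fin 3)) → (EuclideanSpace ℝ (Fin 3)) →L[ℝ] (EuclideanSpace ℝ (Fin 3)))
            (lam' : ℕ → ℝ),
            IsSuitableWeakSolutionOn (slab (EuclideanSpace ℝ (Fin 3)) (Iio 0) isOpen_Iio) 1 0 w q ∧
            HasWeakSpatialGradientOn (slab (EuclideanSpace ℝ (Fin 3)) (Iio 0) isOpen_Iio) w G ∧
            typeIBound (Iio (0 : ℝ) ×ˢ univ) w q G < ⊤ ∧ HasTypeITimeDecay (levelCrit I₀) w ∧
            IsBackwardSingularPoint w 0 ∧ IsScalingUniformlyRecurrent w ∧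
            (∀ (v : ℝ → (EuclideanSpace ℝ (Fin 3)) → (EuclideanSpace ℝ (Fin 3))) (l : ℕ → ℝ),
              (∀ R : ℝ, 0 < R → MemLp (Function.uncurry v) 3
                (volume.restrict (parabolicCylinder R (0 : ℝ × (EuclideanSpace ℝ (Fin 3)))))) →
              (∀ k, 0 < l k) →
              (∀ R : ℝ, 0 < R → Tendsto (fun k => eLpNorm
                (Function.uncurry (nsRescale (l k) w) - Function.uncurry v) 3
                (volume.restrict (parabolicCylinder R (0 : ℝ × (EuclideanSpace ℝ (Fin 3)))))) atTop (𝓝 0)) →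
              ∀ σ : ℝ, (∀ᵐ z ∂(volume.restrict (Iio (0 : ℝ) ×ˢ (univ : Set (EuclideanSpace ℝ (Fin 3))))),
                nsRescale (Real.exp σ) v z.1 z.2 = v z.1 z.2) → σ = 0) ∧
            (∀ k, 0 < lam' k) ∧
            (∀ R : ℝ, 0 < R → Tendsto (fun k => eLpNorm
              (Function.uncurry (nsRescale (lam' k) w) - Function.uncurry U) 3
              (volume.restrict (parabolicCylinder R (0 : ℝ × (EuclideanSpace ℝ (Fin 3)))))) atTop (𝓝 0)))) := by
  obtain ⟨M, I₀, Λ, hI₀, hcrit, hmin, hΛ, U, P, H, hdm, h0, hcell⟩ :=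
    dss_or_recurrent_doublyMin_of_not_scarEnvelopeTypeI h
  refine ⟨M, I₀, Λ, hI₀, hcrit, hmin, hΛ, U, P, H, hdm, h0, ?_, hcell⟩
  have hT : ABTower (levelCrit I₀) U P H := (hdm 0).1.1.1
  obtain ⟨hsw, hgr, hIb, hd⟩ := hT.prClass
  rcases hcell with ⟨lam0, hle, hdss, -⟩ | ⟨-, w, q, G, lam', hw, hG, hB, hdec, hsing, hrec, -, hpos, hlim⟩
  · -- the DSS cell: a periodic orbit of the scaling flow is uniformly recurrent
    have hlam : 1 < lam0 := lt_of_lt_of_le hΛ hle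
    refine ((isDiscretelySelfSimilar_pastCut (one_pos.trans hlam) hdss).isScalingUniformlyRecurrent
      hlam).congr_ae ?_
    refine (ae_restrict_mem (measurableSet_Iio.prod MeasurableSet.univ)).mono fun z hz => ?_
    have hz1 : z.1 < 0 := (Set.mem_prod.1 hz).1
    simp only [if_pos hz1]
  · -- the DSS-free cell: Birkhoff on the hull (A1)
    exact isScalingUniformlyRecurrent_of_hull hw hG hB hdec hsing hrec
      (fun R hR => Summit.NavierStokesRegularity.NavierStokesRegularity.Theorems.memLp_three_of_slabProfile hgr hIb hR)
      hpos hlim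

/-- ★★ **Z11.  23843 ⟸ (ρ), ONE restricted Liouville statement.**  (ρ) «RIGID RECURRENT LIOUVILLE»: no census
object of an exact-critical class which is doubly minimal at every centre and rooted at the origin is uniformly
recurrent under the Navier–Stokes scaling.  (ρ) is crux 1589 `RecurrentLiouville` RESTRICTED to the most rigid
objects the census produces (Z12); it replaces the three cell hypotheses (τ), (κ), (θ) of Z8 by one. -/
theorem scarEnvelopeTypeI_of_noRecurrentDoublyMin
    (hρ : ∀ (M : ℝ) (I₀ : ℝ≥0∞) (U : ℝ → (EuclideanSpace ℝ (Fin 3)) → (EuclideanSpace ℝ (Fin 3)))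
      (P : ℝ → (EuclideanSpace ℝ (Fin 3)) → ℝ)
      (H : ℝ → (EuclideanSpace ℝ (Fin 3)) → (EuclideanSpace ℝ (Fin 3)) →L[ℝ] (EuclideanSpace ℝ (Fin 3))),
      I₀ < ⊤ → levelCrit I₀ ∈ Icc epsL M → minLevel I₀ ≤ I₀ →
      (∀ y : (EuclideanSpace ℝ (Fin 3)), DoublyMin I₀ ⟨U, P, H, y⟩) → ¬ RegPt U 0 →
      IsScalingUniformlyRecurrent U → False) :
    Summit.NavierStokesRegularity.NavierStokesRegularity.Theses.TypeIQuarterGate.ScarEnvelopeTypeI := by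
  by_contra h
  obtain ⟨M, I₀, Λ, hI₀, hcrit, hmin, -, U, P, H, hdm, h0, hrec, -⟩ :=
    recurrent_doublyMin_of_not_scarEnvelopeTypeI h
  exact hρ M I₀ U P H hI₀ hcrit hmin hdm h0 hrec

/-- ★★ **Z13.  THE THREE CELLS, INTRINSIC.**  23843 follows from the exclusion of three kinds of UNIFORMLY
RECURRENT doubly-minimal rooted census objects: (τ) an exactly past-DSS TAME LEAF carrying a Type-I envelope
(factor group `λ₀^ℤ`, `λ₀ ≥ Λ(I₀) > 1`); (κ) an exactly past-DSS WILD object with a `λ₀^ℤ`-invariant off-origin scar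
(a DSS necklace); (θ′) a past-DSS-FREE object, uniformly recurrent under scaling, whose whole `L³_loc` scaling
hull is DSS-free.  Compared with Z8 the third cell no longer mentions the auxiliary model `w` of T6: by A1 the
object itself is uniformly recurrent and by A2 its hull sits inside the DSS-free hull of `w`. -/
theorem scarEnvelopeTypeI_of_recurrentCellExclusions
    (hτ : ∀ (I₀ : ℝ≥0∞) (U : ℝ → (EuclideanSpace ℝ (Fin 3)) → (EuclideanSpace ℝ (Fin 3)))
      (P : ℝ → (EuclideanSpace ℝ (Fin 3)) → ℝ)
      (H : ℝ → (EuclideanSpace ℝ (Fin 3)) → (EuclideanSpace ℝ (Fin 3)) →L[ℝ] (EuclideanSpace ℝ (Fin 3)))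
      (lam0 A : ℝ), (∀ y : (EuclideanSpace ℝ (Fin 3)), DoublyMin I₀ ⟨U, P, H, y⟩) → ¬ RegPt U 0 → 1 < lam0 →
      (∀ t < 0, ∀ x, nsRescale lam0 U t x = U t x) →
      (∀ c : ℝ, 0 < c → ((∀ t < 0, ∀ x, nsRescale c U t x = U t x) ↔ ∃ k : ℤ, c = lam0 ^ k)) →
      LeafNode ⟨U, P, H, 0⟩ → HasTypeIDecay A U → False)
    (hκ : ∀ (I₀ : ℝ≥0∞) (U : ℝ → (EuclideanSpace ℝ (Fin 3)) → (EuclideanSpace ℝ (Fin 3)))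
      (P : ℝ → (EuclideanSpace ℝ (Fin 3)) → ℝ)
      (H : ℝ → (EuclideanSpace ℝ (Fin 3)) → (EuclideanSpace ℝ (Fin 3)) →L[ℝ] (EuclideanSpace ℝ (Fin 3)))
      (lam0 : ℝ) (y : (EuclideanSpace ℝ (Fin 3))),
      (∀ y : (EuclideanSpace ℝ (Fin 3)), DoublyMin I₀ ⟨U, P, H, y⟩) → 1 < lam0 →
      (∀ t < 0, ∀ x, nsRescale lam0 U t x = U t x) →
      (∀ c : ℝ, 0 < c → ((∀ t < 0, ∀ x, nsRescale c U t x = U t x) ↔ ∃ k : ℤ, c = lam0 ^ k)) →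
      y ≠ 0 → ¬ RegPt U y → (∀ k : ℤ, ¬ RegPt U ((lam0 ^ k) • y)) → False)
    (hθ : ∀ (M : ℝ) (I₀ : ℝ≥0∞) (U : ℝ → (EuclideanSpace ℝ (Fin 3)) → (EuclideanSpace ℝ (Fin 3)))
      (P : ℝ → (EuclideanSpace ℝ (Fin 3)) → ℝ)
      (H : ℝ → (EuclideanSpace ℝ (Fin 3)) → (EuclideanSpace ℝ (Fin 3)) →L[ℝ] (EuclideanSpace ℝ (Fin 3))),
      I₀ < ⊤ → levelCrit I₀ ∈ Icc epsL M → minLevel I₀ ≤ I₀ →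
      (∀ y : (EuclideanSpace ℝ (Fin 3)), DoublyMin I₀ ⟨U, P, H, y⟩) → ¬ RegPt U 0 →
      (∀ c : ℝ, 0 < c → (∀ t < 0, ∀ x, nsRescale c U t x = U t x) → c = 1) →
      IsScalingUniformlyRecurrent U →
      (∀ (v : ℝ → (EuclideanSpace ℝ (Fin 3)) → (EuclideanSpace ℝ (Fin 3))) (l : ℕ → ℝ),
        (∀ R : ℝ, 0 < R → MemLp (Function.uncurry v) 3
          (volume.restrict (parabolicCylinder R (0 : ℝ × (EuclideanSpace ℝ (Fin 3)))))) →
        (∀ k, 0 < l k) →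
        (∀ R : ℝ, 0 < R → Tendsto (fun k => eLpNorm
          (Function.uncurry (nsRescale (l k) U) - Function.uncurry v) 3
          (volume.restrict (parabolicCylinder R (0 : ℝ × (EuclideanSpace ℝ (Fin 3)))))) atTop (𝓝 0)) →
        ∀ σ : ℝ, (∀ᵐ z ∂(volume.restrict (Iio (0 : ℝ) ×ˢ (univ : Set (EuclideanSpace ℝ (Fin 3))))),
          nsRescale (Real.exp σ) v z.1 z.2 = v z.1 z.2) → σ = 0) → False) :
    Summit.NavierStokesRegularity.NavierStokesRegularity.Theses.TypeIQuarterGate.ScarEnvelopeTypeI := by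
  by_contra h
  obtain ⟨M, I₀, Λ, hI₀, hcrit, hmin, hΛ, U, P, H, hdm, h0, hrecU, hcell⟩ :=
    recurrent_doublyMin_of_not_scarEnvelopeTypeI h
  rcases hcell with ⟨lam0, hle, hdss, hfac, htl, htd, hwild, hneck⟩ |
      ⟨hfree, w, q, G, lam', -, hG, hB, -, -, -, hhull, hpos, hlim⟩
  · have hlam : 1 < lam0 := lt_of_lt_of_le hΛ hle
    by_cases ht : TameRoot ⟨U, P, H, 0⟩
    · obtain ⟨A, hA⟩ := htd.1 ht
      exact hτ I₀ U P H lam0 A hdm h0 hlam hdss hfac (htl.1 ht) hA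
    · obtain ⟨y, hy, hreg⟩ := hwild.1 ht
      exact hκ I₀ U P H lam0 y hdm hlam hdss hfac hy hreg (hneck y hreg)
  · have hT : ABTower (levelCrit I₀) U P H := (hdm 0).1.1.1
    obtain ⟨-, hgr, hIb, -⟩ := hT.prClass
    have hUlp : ∀ R : ℝ, 0 < R → MemLp (Function.uncurry U) 3
        (volume.restrict (parabolicCylinder R (0 : ℝ × (EuclideanSpace ℝ (Fin 3))))) :=
      fun R hR => Summit.NavierStokesRegularity.NavierStokesRegularity.Theorems.memLp_three_of_slabProfile hgr hIb hR
    have hwlp : ∀ R : ℝ, 0 < R → MemLp (Function.uncurry w) 3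
        (volume.restrict (parabolicCylinder R (0 : ℝ × (EuclideanSpace ℝ (Fin 3))))) :=
      fun R hR => Summit.NavierStokesRegularity.NavierStokesRegularity.Theorems.memLp_three_of_slabProfile hG hB hR
    refine hθ M I₀ U P H hI₀ hcrit hmin hdm h0 hfree hrecU fun v l hv hl hlimv σ hσ => ?_
    obtain ⟨μ, hμ, hlimμ⟩ := exists_scales_tendsto_of_hull_of_hull hwlp hUlp hv hpos hlim hl hlimv
    exact hhull v μ hv hμ hlimμ σ hσ

end HullJunction

end Summit.NavierStokesRegularity.NavierStokesRegularity.Cruxes.ScarEnvelopeTypeI.ZoomDictionary
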